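import Mathlib
import Literature.RingTheory.CohomologyAnnihilator.Basic
import Literature.AlgebraicGeometry.Resolution.IntegralClosureEssFiniteType
import HarnessLib

/-!
# The affine `ca`-blow-up chart is essentially of finite type

Crux `HomologicalConductor.Persistence` (stmt-ResolutionOfSingularities-16484), line `birth`,
registered stub `stub_affineChartEssFiniteType` (finiteness bookkeeping).

For a field extension `K / k`, a `k`-subalgebra `B ⊆ K` essentially of finite type over `k` and
any `x : K`, the affine blow-up chart of the Iyengar–Takahashi cohomology annihilator
`ca B := Literature.RingTheory.CohomologyAnnihilator.cohomologyAnnihilator ↥B`,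
`B[ca B / x] := k[B ∪ {c * x⁻¹ | c ∈ image of ca B in K}]`, is again essentially of finite
type over `k`: `B` is noetherian (`Algebra.EssFiniteType.isNoetherianRing`), so `ca B` is
generated by finitely many `g₁, …, g_r`, every `c * x⁻¹` (`c = Σ bᵢ gᵢ`) is a `B`-linear
combination of the `gᵢ * x⁻¹`, hence `B[ca B / x] = k[B ∪ R₀] = B[R₀]` for the finite set
`R₀ = {gᵢ * x⁻¹}` (`adjoin_ideal_ratios_eq_adjoin_finset`, `Algebra.restrictScalars_adjoin`), and
`B[R₀]` is essentially of finite type by the tree lemma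
`Literature.AlgebraicGeometry.Resolution.essFiniteType_adjoin`. All folklore; the pattern is
`Theorems.SyzygyFlattening.adjoin_ratios_eq_adjoin_finset`.
-/

-- single-problem summit: the doubled namespace component is forced
set_option linter.dupNamespace false

noncomputable section

namespace Summit.ResolutionOfSingularities.ResolutionOfSingularities.Theorems.HomologicalConductor.PersistenceAffineChartEssFiniteType

open Literature.AlgebraicGeometry.Resolution (essFiniteType_adjoin)
open Literature.RingTheory.CohomologyAnnihilator

variable {k K : Type} [Field k] [Field K] [Algebra k K]

/-- **Finitely many ratios suffice.** For a `k`-subalgebra `B ⊆ K`, a finitely generated ideal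
`I` of `B` and any `x : K`, there is a finite `R₀ ⊆ K` with
`k[B ∪ {c * x⁻¹ | c ∈ I}] = k[B ∪ R₀]`: if `g₁, …, g_r` generate `I`, every `c * x⁻¹`,
`c = Σ bᵢ gᵢ ∈ I`, is the `B`-linear combination `Σ bᵢ (gᵢ * x⁻¹)`, so one may take
`R₀ = {gᵢ * x⁻¹}`. [folklore] -/
theorem adjoin_ideal_ratios_eq_adjoin_finset (B : Subalgebra k K) {I : Ideal ↥B} (hI : I.FG)
    (x : K) :
    ∃ R₀ : Finset K, Algebra.adjoin k ((B : Set K) ∪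
        {y : K | ∃ c ∈ ((↑) : ↥B → K) '' (I : Set ↥B), y = c * x⁻¹}) =
      Algebra.adjoin k ((B : Set K) ∪ ↑R₀) := by
  classical
  obtain ⟨G, hG⟩ := hI
  refine ⟨G.image fun g : ↥B => (g : K) * x⁻¹, le_antisymm ?_ ?_⟩
  · apply Algebra.adjoin_le
    rintro y (hy | ⟨c, ⟨b, hb, rfl⟩, rfl⟩)
    · exact Algebra.subset_adjoin (Or.inl hy)
    · have hb' : b ∈ Ideal.span (G : Set ↥B) := by rw [hG]; exact hb
      refine Submodule.span_induction
        (p := fun b _ => ((b : ↥B) : K) * x⁻¹ ∈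
          Algebra.adjoin k ((B : Set K) ∪ ↑(G.image fun g : ↥B => (g : K) * x⁻¹)))
        ?_ ?_ ?_ ?_ hb'
      · intro g hg
        exact Algebra.subset_adjoin (Or.inr (by
          rw [Finset.coe_image]
          exact Set.mem_image_of_mem _ hg))
      · rw [ZeroMemClass.coe_zero, zero_mul]; exact zero_mem _
      · intro a b _ _ ha hb
        rw [AddMemClass.coe_add, add_mul]; exact add_mem ha hb
      · intro r a _ ha
        rw [smul_eq_mul, MulMemClass.coe_mul, mul_assoc]
        exact mul_mem (Algebra.subset_adjoin (Or.inl r.2)) ha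
  · apply Algebra.adjoin_mono
    apply Set.union_subset_union_right
    intro y hy
    rw [Finset.coe_image] at hy
    obtain ⟨g, hg, rfl⟩ := hy
    refine ⟨(g : K), ⟨g, ?_, rfl⟩, rfl⟩
    rw [← hG]
    exact Ideal.subset_span hg

/-- **STUB `stub_affineChartEssFiniteType`: the affine `ca`-blow-up chart is essentially of
finite type.** For `B ⊆ K` essentially of finite type over the field `k` (hence noetherian, so
the cohomology annihilator `ca B = (g₁, …, g_r)` is finitely generated) and any `x : K`,
`B[c * x⁻¹ | c ∈ ca B] = B[g₁ x⁻¹, …, g_r x⁻¹]` is finitely generated over `B`, hence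
essentially of finite type over `k` (tree `essFiniteType_adjoin`). [folklore] -/
theorem stub_affineChartEssFiniteType : ∀ (k K : Type) [Field k] [Field K] [Algebra k K]
    (B : Subalgebra k K) (x : K), Algebra.EssFiniteType k ↥B →
    Algebra.EssFiniteType k ↥(Algebra.adjoin k ((B : Set K) ∪
      {y : K | ∃ c ∈ ((↑) : ↥B → K) ''
        (Literature.RingTheory.CohomologyAnnihilator.cohomologyAnnihilator ↥B : Set ↥B),
        y = c * x⁻¹})) := by
  intro k K _ _ _ B x hB
  haveI := hB
  haveI : IsNoetherianRing ↥B := Algebra.EssFiniteType.isNoetherianRing k ↥B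
  have hfg : (cohomologyAnnihilator ↥B).FG := IsNoetherian.noetherian _
  obtain ⟨R₀, hR₀⟩ := adjoin_ideal_ratios_eq_adjoin_finset B hfg x
  rw [hR₀, ← Algebra.restrictScalars_adjoin]
  exact essFiniteType_adjoin R₀

end Summit.ResolutionOfSingularities.ResolutionOfSingularities.Theorems.HomologicalConductor.PersistenceAffineChartEssFiniteType

end
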